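import Summits.QuantumFields.BalabanUV.Beta.MultiscaleGrowth
import Summits.QuantumFields.BalabanUV.Beta.AccretiveCombesThomasSandwichSiteGrowth
import Summits.QuantumFields.BalabanUV.Beta.MultiscaleDecayRowSumsAdd
import Summits.QuantumFields.BalabanUV.Beta.MultiscaleCombesThomasL2CellsGraded

/-!
# `Summit.QuantumFields.BalabanUV.Beta.MultiscaleGrowthCells` — THE CELL-COUNT GROWTH CLAUSE IS A THEOREM OF THE GRADING (the local
# scale cancels), AND THE (2.16)-CURRENCY ENDs WITH THEIR GROWTH CLAUSES DISCHARGED (MODEL; O.2 item (ii) geometry)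

HONEST FRAMING (page 1 of everything in this cell).  Discharging `FlowStep.BetaPertH` would make Bałaban's ultraviolet
stability UNCONDITIONAL — a constructive-QFT result; it is NOT the continuum limit and NOT the Clay problem.  This module
discharges nothing of `BetaPertH`; [folklore] counting and composition BY NAME, kernel-checked (unit `b2b-balaban-beta-d4-p3`, road P3
«reduction road», gen 11; claim «GROWTH-FROM-GRADING»; companion of `MultiscaleGrowth`).
HONEST DEPENDENCY: continuum YM on T⁴ ⇐ BetaPertH ∧ nine spine estimates (0/9 proved); BetaPertH ⇐ (D1) ∧ (D4) ∧ CAP+tail;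
G-an2-4 gates asym, D1 and NE2/3/4.

CONTENT (kernel, 0 sorry).  Setting: the torus `UT N` partitioned by the cube family of (L2)'s setting (`cellPt`, `hdisj`, `hcover`;
corners `t_k = ctrU (zc k)`, sides `S_{l_k}`, site scale `n = siteScale`), scales comparing along `d_n` as `n(x′) ≤ C_g·n(x)·e^{c·d_n(x,x′)}`.
  §1 `sdist_corner_cellPt_le` (every site of cell `k′` is within `d_n(t_k,t_{k′}) + 2d` of `t_k`: triangle inequality
     `MultiscaleDistanceMetric.sdist_triangle_torus`∕`sdist_comm` + K4 `sdist_corner_thresholds`; the corner scale `n(t_k) = S_{l_k}` is the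
     row owner's `MultiscaleCombesThomasL2CellsGraded.siteScale_ctrU` BY NAME);
  §2 **`cell_growth_raw`**: `#{k′ : d_n(t_k, t_{k′}) < m} ≤ (3C_g²(m + 2d))^d·e^{2cd(m+d)}` — the charts of the counted cells are pairwise
     DISJOINT subsets, of `S_{k′}^d` sites each, of the `d_n`-ball of radius `m + 2d` about `t_k`, counted by `MultiscaleGrowth.card_sdist_lt_le`,
     and `S_{k′} ≥ n(t_k)·e^{−cm}∕C_g` by the comparison read backwards: the local scale `n(t_k)` CANCELS — no volume, no level count, no top
     scale; **`cell_growth`**: the packaged form `≤ N₀·Λ^m`, `Λ = e^{ε + 2cd}`, `N₀ = (3C_g²)^d·(d!∕ε^d)·e^{2d(ε + cd)}`; **`cell_growth_add`**: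
     under the ADDITIVE datum of `MultiscaleDistanceGraded` §4 (`C_g = L^A`, `c = log L∕R`; `Λ = e^ε·L^{2d∕R}`);
  §3 THE ENDs WITH THE GROWTH CLAUSE DISCHARGED, BY NAME: **`wrs_cellSandwich_levelOp_of_grading`** = this lineage's K4b
     `wrs_cellSandwich_levelOp_of_growth` with `hcount` supplied by `cell_growth_add` — `WRS κ′ (d_n on corners) (sandwich (cmat levelOp) q)
     (Nq∕(μ₀S_max⁻²)·e^{4κd}·N₀Λ∕(1 − Λe^{−(κ−κ′)}))`, DATA = the additive grading + the rate condition `Λe^{−(κ−κ′)} < 1` (i.e.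
     `κ − κ′ > ε + 2d·log L∕R`); **`wrs_inv_levelOp_le_of_grading`** = beta-d4-p2's (ii-c)v2 `MultiscaleDecayRowSumsAdd.wrs_inv_levelOp_le_add`
     with `hgrowth` supplied by `MultiscaleGrowth.site_growth_add` (`d₀ = d`; rate `κ − κ′ > ε + (d+1)·log L∕R`).
So the DATA of the (2.16)-currency MODEL ENDs is now {the cube partition, the additive grading `(L, e, A, R)`, a free `ε > 0`, the rate
condition} — the growth clauses are gone; level-free constants; small rate loss exactly when `R ≫ d·log L` (print's «M sufficiently
large», [B6] (2.2)).  WHAT IS NOT HERE: the additive datum for a concrete nested region family (DATA), Dirichlet holes (beta-d4-p2's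
`wrs_dirInv_levelOp_le_add` takes the same `hgrowth` — one more line when wanted), Bałaban's `Q`∕vector operators, print's sup-norm (3.42).

ABSOLUTE RULE.  Nothing printed is cited as a fact; (2.1)–(2.2) ∕ (2.46) ∕ (2.16) ∕ (3.42) are LOCATORS of shapes on [folklore]
declarations.  Row D4: class of (T3) ∕ NODE O.2 ∕ row D4 UNCHANGED (critical-path width 0); D4 DISCHARGE NO DATE; NOT BetaPertH, NOT
continuum, NOT Clay, NOT summit progress.
-/

open scoped BigOperators Matrix ComplexConjugate
open Finset Function

namespace Summit.QuantumFields.BalabanUV.Beta.MultiscaleGrowthCells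

open Summit.QuantumFields.BalabanUV.Beta.MultiscaleDistance
open Summit.QuantumFields.BalabanUV.Beta.MultiscaleDistanceGraded (scale_le_scale_mul_exp_add)
open Summit.QuantumFields.BalabanUV.Beta.MultiscaleDistanceMetric (sdist_comm sdist_triangle_torus)
open Summit.QuantumFields.BalabanUV.Beta.MultiscaleGrowth
open Summit.QuantumFields.BalabanUV.Beta.MultiscaleCombesThomasL2CellsGraded (siteScale_ctrU)
open Literature.MathematicalPhysics.QuantumFieldTheory.Balaban1983to89
open Literature.MathematicalPhysics.QuantumFieldTheory.Balaban1983to89.B9Thm37GluePU (bsrc btgt)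
open B5TorusCover (UT Ctr ctrU)

noncomputable section

/-! ## §1–§2 The CELL clause: disjoint charts inside a `d_n`-ball, the local scale cancels -/

section Cells

open Summit.QuantumFields.BalabanUV.Beta.BoxPoincare (Box card_box)
open Summit.QuantumFields.BalabanUV.Beta.MultiscaleCoerciveTorus (cellPt cubePt_zero cubePt_injective)
open Summit.QuantumFields.BalabanUV.Beta.MultiscaleDecayBudget (cellOf siteScale cellOf_cellPt siteScale_cellPt one_le_siteScale)
open Summit.QuantumFields.BalabanUV.Beta.AccretiveCombesThomasSandwichSite (sdist_corner_thresholds)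

variable {d : ℕ} {N : Fin d → ℕ} [∀ i, NeZero (N i)] [NeZero d] {J K : Type} [Fintype K]
  (S : J → ℕ) (hS : ∀ l, 1 ≤ S l) (hdivS : ∀ l i, S l ∣ N i) (lvl : K → J) (zc : (k : K) → Ctr N (S (lvl k)))

omit [Fintype K] in
/-- Every site of cell `k′` is within `d_n(t_k, t_{k′}) + 2d` of the corner `t_k` (triangle inequality + K4's corner threshold).
[folklore] -/
theorem sdist_corner_cellPt_le (hdisj : ∀ k k' v v', cellPt S hS hdivS lvl zc k v = cellPt S hS hdivS lvl zc k' v' → k = k')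
    (hcover : ∀ x : UT N, ∃ k, ∃ v : Box d (S (lvl k)), cellPt S hS hdivS lvl zc k v = x) (k k' : K) (v : Box d (S (lvl k'))) :
    sdist bsrc btgt (siteScale S hS hdivS lvl zc hcover) (ctrU N (S (lvl k)) (zc k)) (cellPt S hS hdivS lvl zc k' v) ≤
      sdist bsrc btgt (siteScale S hS hdivS lvl zc hcover) (ctrU N (S (lvl k)) (zc k)) (ctrU N (S (lvl k')) (zc k')) + 2 * d := by
  have h1 := sdist_triangle_torus (siteScale S hS hdivS lvl zc hcover) (ctrU N (S (lvl k)) (zc k)) (ctrU N (S (lvl k')) (zc k'))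
    (cellPt S hS hdivS lvl zc k' v)
  have h2 : sdist bsrc btgt (siteScale S hS hdivS lvl zc hcover) (ctrU N (S (lvl k')) (zc k')) (cellPt S hS hdivS lvl zc k' v) ≤
      2 * d := by
    rw [sdist_comm]
    exact (sdist_corner_thresholds S hS hdivS lvl zc hdisj hcover (cellPt S hS hdivS lvl zc k' v) k').1
      (cellOf_cellPt S hS hdivS lvl zc hdisj hcover k' v)
  linarith

/-- **THE RAW CELL COUNT.**  Torus `UT N` partitioned by the cube family (`hdisj`, `hcover`); site scale `n = siteScale` comparing
along `d_n` as `n(x′) ≤ C_g·n(x)·e^{c·d_n(x,x′)}` (`C_g ≥ 1`, `c ≥ 0`).  Then for every cell `k` and `m : ℕ`, with `t_k = ctrU (zc k)`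
the corners: `#{k′ : d_n(t_k, t_{k′}) < m} ≤ (3C_g²(m + 2d))^d·e^{2cd(m+d)}` — the charts of the counted cells are pairwise disjoint
subsets, of `S_{k′}^d` sites each, of the `d_n`-ball of radius `m + 2d` about `t_k` (`card_sdist_lt_le`), and `S_{k′} ≥ n(t_k)e^{−cm}∕C_g`;
the local scale `n(t_k)` CANCELS: no volume, no level count, no top scale. [cite: Balaban1984PropagatorsII, (2.1)-(2.2) p.224] [folklore] -/
theorem cell_growth_raw
    (hdisj : ∀ k k' v v', cellPt S hS hdivS lvl zc k v = cellPt S hS hdivS lvl zc k' v' → k = k')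
    (hcover : ∀ x : UT N, ∃ k, ∃ v : Box d (S (lvl k)), cellPt S hS hdivS lvl zc k v = x) {Cg c : ℝ} (hCg : 1 ≤ Cg) (hc : 0 ≤ c)
    (hgr : ∀ x x', (siteScale S hS hdivS lvl zc hcover x' : ℝ) ≤
      Cg * siteScale S hS hdivS lvl zc hcover x * Real.exp (c * sdist bsrc btgt (siteScale S hS hdivS lvl zc hcover) x x'))
    (k : K) (m : ℕ) :
    ((univ.filter fun k' => sdist bsrc btgt (siteScale S hS hdivS lvl zc hcover) (ctrU N (S (lvl k)) (zc k))
        (ctrU N (S (lvl k')) (zc k')) < m).card : ℝ) ≤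
      (3 * Cg ^ 2 * ((m : ℝ) + 2 * d)) ^ d * Real.exp (2 * c * d * ((m : ℝ) + d)) := by
  classical
  set n := siteScale S hS hdivS lvl zc hcover with hn_def
  have hn1 : ∀ x, 1 ≤ n x := fun x => one_le_siteScale S hS hdivS lvl zc hcover x
  have hd : (1 : ℝ) ≤ d := by exact_mod_cast Nat.one_le_iff_ne_zero.mpr (NeZero.ne d)
  set Kc := univ.filter fun k' => sdist bsrc btgt n (ctrU N (S (lvl k)) (zc k)) (ctrU N (S (lvl k')) (zc k')) < m with hKc
  set r' : ℝ := (m : ℝ) + 2 * d with hr'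
  have hm0 : (0 : ℝ) ≤ m := Nat.cast_nonneg m
  have hr'1 : 1 ≤ r' := by rw [hr']; linarith
  have hr'0 : 0 ≤ r' := by linarith
  set n₀ : ℝ := (n (ctrU N (S (lvl k)) (zc k)) : ℝ) with hn₀
  have hn₀1 : 1 ≤ n₀ := by rw [hn₀]; exact_mod_cast hn1 _
  -- (1) the `d_n`-ball of radius `r'` about `t_k` and its count
  set T := univ.filter fun y : UT N => sdist bsrc btgt n (ctrU N (S (lvl k)) (zc k)) y < r' with hT
  have hTcard : (T.card : ℝ) ≤ (2 * ⌊Cg * n₀ * Real.exp (c * r') * r'⌋₊ + 1 : ℝ) ^ d :=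
    card_sdist_lt_le n hn1 hCg hc hgr _ hr'0
  -- (2) the charts of the counted cells lie in `T` and are pairwise disjoint
  have himg_sub : ∀ k' ∈ Kc, (univ.image (cellPt S hS hdivS lvl zc k')) ⊆ T := by
    intro k' hk' y hy
    rw [Finset.mem_image] at hy
    obtain ⟨v, _, rfl⟩ := hy
    rw [hT, Finset.mem_filter]
    refine ⟨Finset.mem_univ _, ?_⟩
    have hlt : sdist bsrc btgt n (ctrU N (S (lvl k)) (zc k)) (ctrU N (S (lvl k')) (zc k')) < m := (Finset.mem_filter.mp hk').2
    have h1 := sdist_corner_cellPt_le S hS hdivS lvl zc hdisj hcover k k' v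
    rw [hr']
    linarith
  have hdisjoint : ∀ k' ∈ Kc, ∀ k'' ∈ Kc, k' ≠ k'' →
      Disjoint (univ.image (cellPt S hS hdivS lvl zc k')) (univ.image (cellPt S hS hdivS lvl zc k'')) := by
    intro k' _ k'' _ hne
    rw [Finset.disjoint_left]
    intro y hy hy'
    rw [Finset.mem_image] at hy hy'
    obtain ⟨v, _, hv⟩ := hy
    obtain ⟨w, _, hw⟩ := hy'
    exact hne (hdisj k' k'' v w (hv.trans hw.symm))
  -- (3) `Σ_{k' ∈ Kc} S_{k'}^d ≤ #T`
  have hsum : ∑ k' ∈ Kc, (S (lvl k') : ℝ) ^ d ≤ T.card := by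
    have hcard_img : ∀ k', (univ.image (cellPt S hS hdivS lvl zc k')).card = S (lvl k') ^ d := fun k' => by
      have hinj : Function.Injective (cellPt S hS hdivS lvl zc k') := cubePt_injective (hS (lvl k')) (hdivS (lvl k')) (zc k')
      rw [Finset.card_image_of_injective _ hinj, Finset.card_univ, card_box]
    have hsub : Kc.biUnion (fun k' => univ.image (cellPt S hS hdivS lvl zc k')) ⊆ T :=
      Finset.biUnion_subset.mpr himg_sub
    have h := Finset.card_le_card hsub
    rw [Finset.card_biUnion hdisjoint] at h
    simp_rw [hcard_img] at h
    exact_mod_cast h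
  -- (4) the counted cells are not too fine: `n₀ ≤ C_g e^{cm} S_{k'}`
  have hlow : ∀ k' ∈ Kc, n₀ ≤ Cg * Real.exp (c * m) * (S (lvl k') : ℝ) := by
    intro k' hk'
    have hlt := (Finset.mem_filter.mp hk').2
    have h := hgr (ctrU N (S (lvl k')) (zc k')) (ctrU N (S (lvl k)) (zc k))
    have hsc : n (ctrU N (S (lvl k')) (zc k')) = S (lvl k') := by
      rw [hn_def]; exact siteScale_ctrU S hS hdivS lvl zc hdisj hcover k'
    rw [hsc, sdist_comm] at h
    calc n₀ ≤ Cg * (S (lvl k') : ℝ) * Real.exp (c * sdist bsrc btgt n (ctrU N (S (lvl k)) (zc k)) (ctrU N (S (lvl k')) (zc k'))) := h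
      _ ≤ Cg * (S (lvl k') : ℝ) * Real.exp (c * m) :=
          mul_le_mul_of_nonneg_left (Real.exp_le_exp.mpr (mul_le_mul_of_nonneg_left hlt.le hc)) (by positivity)
      _ = Cg * Real.exp (c * m) * (S (lvl k') : ℝ) := by ring
  -- (5) `#Kc · σ^d ≤ #T`, `σ = n₀ ∕ (C_g e^{cm})`
  set σ : ℝ := n₀ / (Cg * Real.exp (c * m)) with hσ
  have hσpos : 0 < σ := by positivity
  have hσle : ∀ k' ∈ Kc, σ ^ d ≤ (S (lvl k') : ℝ) ^ d := fun k' hk' =>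
    pow_le_pow_left₀ hσpos.le (by rw [hσ, div_le_iff₀ (by positivity)]; linarith [hlow k' hk']) d
  have h5 : (Kc.card : ℝ) * σ ^ d ≤ T.card :=
    calc (Kc.card : ℝ) * σ ^ d = ∑ _k' ∈ Kc, σ ^ d := by rw [Finset.sum_const, nsmul_eq_mul]
      _ ≤ ∑ k' ∈ Kc, (S (lvl k') : ℝ) ^ d := Finset.sum_le_sum hσle
      _ ≤ T.card := hsum
  -- (6) numbers
  have hν1 : 1 ≤ Cg * n₀ * Real.exp (c * r') :=
    one_le_mul_of_one_le_of_one_le (one_le_mul_of_one_le_of_one_le hCg hn₀1) (Real.one_le_exp (by positivity))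
  have hνr : 1 ≤ Cg * n₀ * Real.exp (c * r') * r' := one_le_mul_of_one_le_of_one_le hν1 hr'1
  have hfloor : (2 * ⌊Cg * n₀ * Real.exp (c * r') * r'⌋₊ + 1 : ℝ) ≤ 3 * (Cg * n₀ * Real.exp (c * r') * r') := by
    have := Nat.floor_le (by positivity : 0 ≤ Cg * n₀ * Real.exp (c * r') * r')
    linarith
  have hT2 : (T.card : ℝ) ≤ (3 * (Cg * n₀ * Real.exp (c * r') * r')) ^ d :=
    hTcard.trans (pow_le_pow_left₀ (by positivity) hfloor d)
  have h6 : (Kc.card : ℝ) ≤ (3 * (Cg * n₀ * Real.exp (c * r') * r')) ^ d / σ ^ d := by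
    rw [le_div_iff₀ (pow_pos hσpos d)]
    exact h5.trans hT2
  have h7 : (3 * (Cg * n₀ * Real.exp (c * r') * r')) ^ d / σ ^ d =
      (3 * Cg ^ 2 * r') ^ d * (Real.exp (c * r') * Real.exp (c * m)) ^ d := by
    rw [← div_pow, ← mul_pow]
    congr 1
    have hn₀0 : n₀ ≠ 0 := (lt_of_lt_of_le one_pos hn₀1).ne'
    rw [hσ, div_div_eq_mul_div, div_eq_iff hn₀0]
    ring
  have h8 : (Real.exp (c * r') * Real.exp (c * m)) ^ d = Real.exp (2 * c * d * ((m : ℝ) + d)) := by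
    rw [← Real.exp_add, ← Real.exp_nat_mul, hr']
    congr 1
    ring
  calc (Kc.card : ℝ) ≤ (3 * (Cg * n₀ * Real.exp (c * r') * r')) ^ d / σ ^ d := h6
    _ = (3 * Cg ^ 2 * r') ^ d * Real.exp (2 * c * d * ((m : ℝ) + d)) := by rw [h7, h8]

/-- **CELL GROWTH FROM THE GRADED COMPARISON** — the clause `hcount` of this lineage's
`AccretiveCombesThomasSandwichSiteGrowth.wrs_cellSandwich_levelOp_of_growth`, AS A THEOREM: same setting, for every `ε > 0`,
`#{k′ : d_n(t_k, t_{k′}) < m} ≤ N₀·Λ^m` with `Λ = e^{ε + 2cd}`, `N₀ = (3C_g²)^d·(d!∕ε^d)·e^{2d(ε + cd)}` — constants seeing `d, C_g, c, ε`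
only. [cite: Balaban1984PropagatorsII, (2.1)-(2.2) p.224; Balaban1988RG2Cluster, (2.16) p.16] [folklore] -/
theorem cell_growth
    (hdisj : ∀ k k' v v', cellPt S hS hdivS lvl zc k v = cellPt S hS hdivS lvl zc k' v' → k = k')
    (hcover : ∀ x : UT N, ∃ k, ∃ v : Box d (S (lvl k)), cellPt S hS hdivS lvl zc k v = x) {Cg c : ℝ} (hCg : 1 ≤ Cg) (hc : 0 ≤ c)
    (hgr : ∀ x x', (siteScale S hS hdivS lvl zc hcover x' : ℝ) ≤
      Cg * siteScale S hS hdivS lvl zc hcover x * Real.exp (c * sdist bsrc btgt (siteScale S hS hdivS lvl zc hcover) x x'))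
    {ε : ℝ} (hε : 0 < ε) (k : K) (m : ℕ) :
    ((univ.filter fun k' => sdist bsrc btgt (siteScale S hS hdivS lvl zc hcover) (ctrU N (S (lvl k)) (zc k))
        (ctrU N (S (lvl k')) (zc k')) < m).card : ℝ) ≤
      (3 * Cg ^ 2) ^ d * ((d.factorial : ℝ) / ε ^ d) * Real.exp (2 * d * (ε + c * d)) * Real.exp (ε + 2 * c * d) ^ m := by
  have h1 := cell_growth_raw S hS hdivS lvl zc hdisj hcover hCg hc hgr k m
  have hm0 : (0 : ℝ) ≤ m := Nat.cast_nonneg m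
  have h2 : ((m : ℝ) + 2 * d) ^ d ≤ (d.factorial : ℝ) / ε ^ d * Real.exp (ε * ((m : ℝ) + 2 * d)) :=
    pow_le_factorial_div_mul_exp (by positivity) hε d
  have hexp : Real.exp (ε * ((m : ℝ) + 2 * d)) * Real.exp (2 * c * d * ((m : ℝ) + d)) =
      Real.exp (2 * d * (ε + c * d)) * Real.exp (ε + 2 * c * d) ^ m := by
    rw [← Real.exp_nat_mul, ← Real.exp_add, ← Real.exp_add]
    congr 1
    ring
  calc _ ≤ (3 * Cg ^ 2 * ((m : ℝ) + 2 * d)) ^ d * Real.exp (2 * c * d * ((m : ℝ) + d)) := h1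
    _ = (3 * Cg ^ 2) ^ d * ((m : ℝ) + 2 * d) ^ d * Real.exp (2 * c * d * ((m : ℝ) + d)) := by rw [mul_pow]
    _ ≤ (3 * Cg ^ 2) ^ d * ((d.factorial : ℝ) / ε ^ d * Real.exp (ε * ((m : ℝ) + 2 * d))) *
          Real.exp (2 * c * d * ((m : ℝ) + d)) :=
        mul_le_mul_of_nonneg_right (mul_le_mul_of_nonneg_left h2 (by positivity)) (Real.exp_pos _).le
    _ = (3 * Cg ^ 2) ^ d * ((d.factorial : ℝ) / ε ^ d) *
          (Real.exp (ε * ((m : ℝ) + 2 * d)) * Real.exp (2 * c * d * ((m : ℝ) + d))) := by ring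
    _ = _ := by rw [hexp]; ring

/-- **CELL GROWTH UNDER THE ADDITIVE GRADING**: for every `ε > 0`, `#{k′ : d_n(t_k, t_{k′}) < m} ≤ N₀·Λ^m` with
`Λ = e^{ε + 2d·log L∕R} = e^ε·L^{2d∕R}`, `N₀ = (3L^{2A})^d·(d!∕ε^d)·e^{2d(ε + d·log L∕R)}` — this lineage's `hcount` with constants from
`(d, L, A, R, ε)` ONLY (`scale_le_scale_mul_exp_add` BY NAME + `cell_growth`). [cite: Balaban1984PropagatorsII, (2.1)-(2.2) p.224] [folklore] -/
theorem cell_growth_add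
    (hdisj : ∀ k k' v v', cellPt S hS hdivS lvl zc k v = cellPt S hS hdivS lvl zc k' v' → k = k')
    (hcover : ∀ x : UT N, ∃ k, ∃ v : Box d (S (lvl k)), cellPt S hS hdivS lvl zc k v = x)
    {L : ℕ} (hL : 1 ≤ L) (e : UT N → ℕ) (hne : ∀ x, siteScale S hS hdivS lvl zc hcover x = L ^ e x) {R : ℝ} (hR : 0 < R) {A : ℕ}
    (hadd : ∀ x y : UT N, |(e x : ℝ) - e y| ≤ A + sdist bsrc btgt (siteScale S hS hdivS lvl zc hcover) x y / R)
    {ε : ℝ} (hε : 0 < ε) (k : K) (m : ℕ) :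
    ((univ.filter fun k' => sdist bsrc btgt (siteScale S hS hdivS lvl zc hcover) (ctrU N (S (lvl k)) (zc k))
        (ctrU N (S (lvl k')) (zc k')) < m).card : ℝ) ≤
      (3 * ((L : ℝ) ^ A) ^ 2) ^ d * ((d.factorial : ℝ) / ε ^ d) * Real.exp (2 * d * (ε + Real.log L / R * d)) *
        Real.exp (ε + 2 * (Real.log L / R) * d) ^ m :=
  cell_growth S hS hdivS lvl zc hdisj hcover (one_le_pow₀ (by exact_mod_cast hL))
    (div_nonneg (Real.log_nonneg (by exact_mod_cast hL)) hR.le)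
    (fun x x' => scale_le_scale_mul_exp_add bsrc btgt _ hL e hne (A := A) (hadd x x')) hε k m

end Cells

/-! ## §3 The (2.16)-currency ENDs with their growth clauses DISCHARGED (BY NAME) -/

section Ends

open Summit.QuantumFields.BalabanUV.Beta.BoxPoincare (Box)
open Summit.QuantumFields.BalabanUV.Beta.MultiscaleCoerciveTorus
open Summit.QuantumFields.BalabanUV.Beta.MultiscaleDecayBudget
open Summit.QuantumFields.BalabanUV.Beta.AccretiveCombesThomas
open Summit.QuantumFields.BalabanUV.Beta.AccretiveCombesThomasSandwich (sandwich)
open Summit.QuantumFields.BalabanUV.Beta.AccretiveCombesThomasSandwichSiteGrowth (wrs_cellSandwich_levelOp_of_growth)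
open Summit.QuantumFields.BalabanUV.Beta.MultiscaleDecayRowSumsAdd (wrs_inv_levelOp_le_add)
open Summit.QuantumFields.BalabanUV.Beta.CovariantTowerMatrix (cmat)
open Literature.MathematicalPhysics.QuantumFieldTheory.Balaban1983to89.B9Thm37GlueTorusCov (tblk)
open Literature.MathematicalPhysics.QuantumFieldTheory.Balaban1983to89.B9Thm37GlueTorusCovLevels (levelOp)
open Literature.MathematicalPhysics.QuantumFieldTheory.Balaban1983to89.B5Prop11Lower (nsq)
open Literature.MathematicalPhysics.QuantumFieldTheory.Balaban1983to89.B13PerturbativeStep (WRS)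

variable {d : ℕ} {N : Fin d → ℕ} [∀ i, NeZero (N i)] [NeZero d] {Cp J K : Type} [Fintype Cp] [DecidableEq Cp]
  [Fintype J] [Fintype K] (S : J → ℕ) (hS : ∀ l, 1 ≤ S l) (hdivS : ∀ l i, S l ∣ N i) (lvl : K → J)
  (zc : (k : K) → Ctr N (S (lvl k)))

/-- **LEVEL-FREE WRS OF THE CELL-LATTICE SANDWICH OF THE MULTI-REGION MODEL OPERATOR, GROWTH CLAUSE DISCHARGED.**  K4b's
`wrs_cellSandwich_levelOp_of_growth` (setting of `MultiscaleDecay.hc_levelOp`; test vectors `q_k` supported in cell `k`, `‖q_k‖² ≤ Nq`;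
`S_l ≤ S_max`) with its cell-count clause `hcount` SUPPLIED by `cell_growth_add` from the ADDITIVE GRADING `siteScale = L^e`,
`|e(x) − e(y)| ≤ A + d_n(x,y)∕R` (`L ≥ 1`, `R > 0`) and a free `ε > 0`: with `Λ = e^{ε + 2d·log L∕R}`,
`N₀ = (3L^{2A})^d·(d!∕ε^d)·e^{2d(ε + d·log L∕R)}` and the rate condition `Λe^{−(κ−κ′)} < 1`,
`WRS κ′ (d_n on corners) (sandwich (cmat levelOp) q) (Nq∕(μ₀S_max⁻²)·e^{2κ·2d}·N₀Λ∕(1 − Λe^{−(κ−κ′)}))` — DATA = partition + grading + rate only.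
[cite: Balaban1988RG2Cluster, (2.16) p.16; Balaban1984PropagatorsII, (2.1)-(2.2) p.224] [folklore] -/
theorem wrs_cellSandwich_levelOp_of_grading [Nonempty Cp]
    (hdisj : ∀ k k' v v', cellPt S hS hdivS lvl zc k v = cellPt S hS hdivS lvl zc k' v' → k = k')
    (hcover : ∀ x : UT N, ∃ k, ∃ v : Box d (S (lvl k)), cellPt S hS hdivS lvl zc k v = x)
    (Rm : UT N × Fin d → Cp → Cp → ℝ) (hRm : ∀ b i j, ∑ k, Rm b k i * Rm b k j = if i = j then (1 : ℝ) else 0)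
    (T : J → UT N → Cp → Cp → ℝ) (hT : ∀ l x i i', ∑ k, T l x k i * T l x k i' = if i = i' then (1 : ℝ) else 0)
    (a : J → ℝ) (ha : ∀ j, 0 ≤ a j) (ω : J → UT N → ℝ)
    (hsupp : ∀ l x, ω l (ctrU N (S l) (tblk (hS l) (hdivS l) x)) ≠ 0 → ∃ k v, lvl k = l ∧ cellPt S hS hdivS lvl zc k v = x)
    {amax : ℝ} (hamax : 0 ≤ amax)
    (hscale : ∀ k, a (lvl k) * ω (lvl k) (ctrU N (S (lvl k)) (zc k)) ^ 2 * (S (lvl k) : ℝ) ^ d ≤ amax / (S (lvl k) : ℝ) ^ 2)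
    (c : UT N × Fin d → ℝ) {cmax : ℝ} (hc : ∀ b, |c b| ≤ cmax) {C : ℝ}
    (hcoer : ∀ f : UT N × Cp → ℝ,
      C * ∑ k, ((S (lvl k) : ℝ) ^ 2)⁻¹ * ∑ v : Box d (S (lvl k)), ∑ i, f (cellPt S hS hdivS lvl zc k v, i) ^ 2 ≤
        ∑ p, f p * levelOp bsrc btgt c Rm (fun l x => ctrU N (S l) (tblk (hS l) (hdivS l) x))
          (fun l x => ω l (ctrU N (S l) (tblk (hS l) (hdivS l) x))) T a f p)
    {κ : ℝ} (hκ0 : 0 ≤ κ) (hκ1 : κ ≤ 1) (hμ : 0 < C - 2 * d * cmax ^ 2 * κ ^ 2 - amax * (Real.exp (2 * d * κ) - 1))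
    {Smax : ℕ} (hSmax1 : 1 ≤ Smax) (hSmax : ∀ l, S l ≤ Smax)
    (q : K → UT N × Cp → ℂ) (hq : ∀ k p, cellOf S hS hdivS lvl zc hcover p.1 ≠ k → q k p = 0) {Nq : ℝ} (hNq0 : 0 ≤ Nq)
    (hNq : ∀ k, nsq (q k) ≤ Nq)
    {L : ℕ} (hL : 1 ≤ L) (e : UT N → ℕ) (hne : ∀ x, siteScale S hS hdivS lvl zc hcover x = L ^ e x) {R : ℝ} (hR : 0 < R) {A : ℕ}
    (hadd : ∀ x y : UT N, |(e x : ℝ) - e y| ≤ A + sdist bsrc btgt (siteScale S hS hdivS lvl zc hcover) x y / R)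
    {ε : ℝ} (hε : 0 < ε) {κ' : ℝ} (hκ' : κ' ≤ κ)
    (hrate : Real.exp (ε + 2 * (Real.log L / R) * d) * Real.exp (-(κ - κ')) < 1) :
    WRS κ' (fun k k' => sdist bsrc btgt (siteScale S hS hdivS lvl zc hcover) (ctrU N (S (lvl k)) (zc k))
        (ctrU N (S (lvl k')) (zc k')))
      (sandwich (cmat (levelOp bsrc btgt c Rm (fun l x => ctrU N (S l) (tblk (hS l) (hdivS l) x))
        (fun l x => ω l (ctrU N (S l) (tblk (hS l) (hdivS l) x))) T a)) q)
      (Nq / ((C - 2 * d * cmax ^ 2 * κ ^ 2 - amax * (Real.exp (2 * d * κ) - 1)) * ((Smax : ℝ) ^ 2)⁻¹) *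
        Real.exp (2 * κ * (2 * d)) *
        ((3 * ((L : ℝ) ^ A) ^ 2) ^ d * ((d.factorial : ℝ) / ε ^ d) * Real.exp (2 * d * (ε + Real.log L / R * d)) *
            Real.exp (ε + 2 * (Real.log L / R) * d) /
          (1 - Real.exp (ε + 2 * (Real.log L / R) * d) * Real.exp (-(κ - κ'))))) :=
  wrs_cellSandwich_levelOp_of_growth S hS hdivS lvl zc hdisj hcover Rm hRm T hT a ha ω hsupp hamax hscale c hc hcoer hκ0 hκ1 hμ
    hSmax1 hSmax q hq hNq0 hNq (by positivity) (Real.exp_pos _).le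
    (cell_growth_add S hS hdivS lvl zc hdisj hcover hL e hne hR hadd hε) hκ' hrate

/-- **LEVEL-FREE WEIGHTED ROW SUMS OF `(levelOp)⁻¹`, GROWTH CLAUSE DISCHARGED.**  beta-d4-p2's (ii-c)v2
`MultiscaleDecayRowSumsAdd.wrs_inv_levelOp_le_add` with its site-count clause `hgrowth` (`d₀ = d`) SUPPLIED by
`MultiscaleGrowth.site_growth_add` from the same additive grading and a free `ε > 0`: with `Λ = e^{ε + d·log L∕R}`, `G₀ = (3L^A)^d·(d!∕ε^d)`
and the rate condition `0 ≤ κ − κ′ − log L∕R`, `Λe^{−(κ−κ′−log L∕R)} < 1`,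
`Σ_q |(levelOp)⁻¹(δ_q)(p)|·e^{κ′d_n(p₁,q₁)} ≤ μ₀⁻¹·L^A·|Cp|·G₀Λ∕(1 − Λe^{−(κ−κ′−log L∕R)})·n(p₁)^{d+2}` — DATA = partition + grading + rate only.
[cite: Balaban1988RG2Cluster, (2.16) p.15; Balaban1985BackgroundPropagators, (3.41)-(3.42) p.397; Balaban1984PropagatorsII, (2.1)-(2.2) p.224]
[folklore] -/
theorem wrs_inv_levelOp_le_of_grading
    (hdisj : ∀ k k' v v', cellPt S hS hdivS lvl zc k v = cellPt S hS hdivS lvl zc k' v' → k = k')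
    (hcover : ∀ x : UT N, ∃ k, ∃ v : Box d (S (lvl k)), cellPt S hS hdivS lvl zc k v = x)
    (Rm : UT N × Fin d → Cp → Cp → ℝ) (hRm : ∀ b i j, ∑ k, Rm b k i * Rm b k j = if i = j then (1 : ℝ) else 0)
    (T : J → UT N → Cp → Cp → ℝ) (hT : ∀ l x i i', ∑ k, T l x k i * T l x k i' = if i = i' then (1 : ℝ) else 0)
    (a : J → ℝ) (ha : ∀ j, 0 ≤ a j) (ω : J → UT N → ℝ)
    (hsupp : ∀ l x, ω l (ctrU N (S l) (tblk (hS l) (hdivS l) x)) ≠ 0 → ∃ k v, lvl k = l ∧ cellPt S hS hdivS lvl zc k v = x)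
    {amax : ℝ} (hamax : 0 ≤ amax)
    (hscale : ∀ k, a (lvl k) * ω (lvl k) (ctrU N (S (lvl k)) (zc k)) ^ 2 * (S (lvl k) : ℝ) ^ d ≤ amax / (S (lvl k) : ℝ) ^ 2)
    (c : UT N × Fin d → ℝ) {cmax : ℝ} (hc : ∀ b, |c b| ≤ cmax) {C : ℝ}
    (hcoer : ∀ f : UT N × Cp → ℝ,
      C * ∑ k, ((S (lvl k) : ℝ) ^ 2)⁻¹ * ∑ v : Box d (S (lvl k)), ∑ i, f (cellPt S hS hdivS lvl zc k v, i) ^ 2 ≤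
        ∑ p, f p * levelOp bsrc btgt c Rm (fun l x => ctrU N (S l) (tblk (hS l) (hdivS l) x))
          (fun l x => ω l (ctrU N (S l) (tblk (hS l) (hdivS l) x))) T a f p)
    {κ : ℝ} (hκ0 : 0 ≤ κ) (hκ1 : κ ≤ 1) (hμ : 0 < C - 2 * d * cmax ^ 2 * κ ^ 2 - amax * (Real.exp (2 * d * κ) - 1))
    {L : ℕ} (hL : 1 ≤ L) (e : UT N → ℕ) (hne : ∀ x, siteScale S hS hdivS lvl zc hcover x = L ^ e x) {R : ℝ} (hR : 0 < R) {A : ℕ}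
    (hadd : ∀ x y : UT N, |(e x : ℝ) - e y| ≤ A + sdist bsrc btgt (siteScale S hS hdivS lvl zc hcover) x y / R)
    {ε : ℝ} (hε : 0 < ε) {κ' : ℝ} (hδ : 0 ≤ κ - κ' - Real.log L / R)
    (hrate : Real.exp (ε + Real.log L / R * d) * Real.exp (-(κ - κ' - Real.log L / R)) < 1) (p : UT N × Cp) :
    ∑ q, |Ring.inverse (levelOp bsrc btgt c Rm (fun l x => ctrU N (S l) (tblk (hS l) (hdivS l) x))
          (fun l x => ω l (ctrU N (S l) (tblk (hS l) (hdivS l) x))) T a) (Pi.single q 1) p| *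
        Real.exp (κ' * sdist bsrc btgt (siteScale S hS hdivS lvl zc hcover) p.1 q.1) ≤
      (C - 2 * d * cmax ^ 2 * κ ^ 2 - amax * (Real.exp (2 * d * κ) - 1))⁻¹ * (L : ℝ) ^ A * (Fintype.card Cp) *
        ((3 * (L : ℝ) ^ A) ^ d * ((d.factorial : ℝ) / ε ^ d) * Real.exp (ε + Real.log L / R * d) /
          (1 - Real.exp (ε + Real.log L / R * d) * Real.exp (-(κ - κ' - Real.log L / R)))) *
        (siteScale S hS hdivS lvl zc hcover p.1 : ℝ) ^ (d + 2) :=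
  wrs_inv_levelOp_le_add S hS hdivS lvl zc hdisj hcover Rm hRm T hT a ha ω hsupp hamax hscale c hc hcoer hκ0 hκ1 hμ hL e hne hadd
    (by positivity) (Real.exp_pos _).le (site_growth_add S hS hdivS lvl zc hcover hL e hne hR hadd hε) hδ hrate p

end Ends

end

end Summit.QuantumFields.BalabanUV.Beta.MultiscaleGrowthCells
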